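import Literature.NumberTheory.LFunctions.XiIntegralProofs
import Literature.NumberTheory.LFunctions.XiIntegralLimitProofs
import Mathlib.Analysis.SpecialFunctions.Pow.Asymptotics
import HarnessLib

/-!
# The integral of Riemann's `ξ` (Lagarias–Montague 2011): uniform limits on vertical strips — proved

Literature/NumberTheory/LFunctions, fourth companion ("Proofs") file of `XiIntegral.lean` (next to
`XiIntegralProofs.lean` — Lemma 3.3 (1) and the §5 horizontal bound —, `XiIntegralLimitProofs.lean` —
Thm. 2.1 (1) — and `XiIntegralWintnerProofs.lean`). It DISCHARGES the named fact
`Literature.NumberTheory.LFunctions.LagariasMontague2011_sec5_uniform` (J. C. Lagarias, D. Montague, *The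
integral of the Riemann ξ-function*, Comment. Math. Univ. St. Pauli 60 (2011) 143–169, arXiv:1106.4348, §5,
facts (1)–(2) opening the proof of Thm. 2.2, p. 13):

  `ξ^{(-1)}(σ + it) → iA₀` as `t → +∞` and `ξ^{(-1)}(σ + it) → −iA₀` as `t → −∞`, uniformly on every vertical
  strip `σ₁ ≤ σ ≤ σ₂` (`ξ^{(-1)} = xiIntegral`, `A₀ = xiIntegralLimit = 2π·deBruijnPhi 0`).

Nothing new is posited (no definitions, no named facts).

## Proof

The paper (§5, p. 13) derives both facts "directly from Theorem 2.1, using the well known fact that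
`|ξ(s)| → 0` as `|t| → ∞`, uniformly on any vertical strip", through
`ξ^{(-1)}(σ₀ + it) = ξ^{(-1)}(½ + it) + ∫_{1/2}^{σ₀} ξ(σ + it) dσ`. We organise the argument as follows
(all inputs are in the tree):

1. **Symmetries** (`norm_xiIntegral_conj_add`, `norm_xiIntegral_one_sub_conj_sub`): from
   `ξ^{(-1)}(s̄) = conj ξ^{(-1)}(s)` and `ξ^{(-1)}(1 − s̄) = −conj ξ^{(-1)}(s)` (tree:
   `riemannXiPrimitive_conj`, `riemannXiPrimitive_one_sub_conj`; `riemannXiPrimitive = xiIntegral`) and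
   `conj(iA₀) = −iA₀`:  `‖ξ^{(-1)}(σ − it) + iA₀‖ = ‖ξ^{(-1)}(σ + it) − iA₀‖ = ‖ξ^{(-1)}((1−σ) + it) − iA₀‖`.
   Hence the `t → −∞` statement is the `t → +∞` one, and abscissae `σ < ½` reduce to `1 − σ > ½`: it
   suffices to treat the right half-strips `½ ≤ σ ≤ S`, `t → +∞`.
2. **Decay of `ξ` on right half-strips** (`exists_tendsto_norm_riemannXi_le`): for every `S` there is
   `g → 0` with `‖ξ(x + it)‖ ≤ g(t)` for `½ ≤ x ≤ S`, `t ≥ 2`. On `½ ≤ x ≤ 2` this is Lemma 3.3 (1)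
   (`LagariasMontague2011_lem_3_3_i_holds`, `≤ C₁ e^{−πt/4}(t+1)^{5/2}`); on `2 ≤ x ≤ 2(N+1)` we use
   `ξ(s) = ½ s(s−1) π^{−s/2} Γ(s/2) ζ(s)` with `‖ζ(s)‖ ≤ x/(x−1) ≤ 2` and the Stirling-order bound
   `‖Γ(x' + iy)‖ ≤ 16π² (x' + |y| + N)^N (1 + |y|)^{1/2} e^{−π|y|/2}` on `0 < x' ≤ N + 1`, `|y| ≥ 1`
   (`norm_Gamma_le_pow_mul_exp`: induction on `N` by `Γ(z+1) = zΓ(z)` from the tree's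
   `Literature.Analysis.SpecialFunctions.norm_Gamma_le_exp` on `0 < x' ≤ 1`), giving
   `‖ξ(x + it)‖ ≤ 16π² (x + t + N)^{N+3} e^{−πt/4}` (`norm_riemannXi_le_pow_mul_exp`); `tᵏe^{−πt/4} → 0`.
3. **Assembly** (`xiIntegral_tendsto_uniform_right`, then the discharge): with
   `ξ^{(-1)}(x + it) − ξ^{(-1)}(½ + it) = ∫_{1/2}^{x} ξ(y + it) dy` (`xiIntegral_sub_eq_integral_horizontal`)
   of length `≤ S − ½` and Thm. 2.1 (1) (`LagariasMontague2011_thm_2_1_i_holds`), an `ε/4 + ε/2` bound.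

## References
* J. C. Lagarias, D. Montague, *The integral of the Riemann ξ-function*, Comment. Math. Univ. St. Pauli 60
  (2011), 143–169; arXiv:1106.4348 — §5 (facts (1)–(2), p. 13), Thm. 2.1 (1), Lemma 3.3 (1). [LagariasMontague2011]
* E. C. Titchmarsh, *The Theory of the Riemann Zeta-Function*, 2nd ed., Oxford 1986, §2.1 (2.1.12), §4.12
  (4.12.2). [Titchmarsh1986]
-/

noncomputable section

open Complex MeasureTheory Real Set Asymptotics
open _root_.Filter
open scoped _root_.Topology ComplexConjugate

namespace Literature.NumberTheory.LFunctions

/-! ## Step 1: symmetries of the deviation `‖ξ^{(-1)}(s) − iA₀‖` -/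

/-- `conj (iA₀) = −iA₀` (`A₀` is real). [folklore] -/
theorem conj_xiIntegralLimit_mul_I :
    conj ((xiIntegralLimit : ℂ) * I) = -((xiIntegralLimit : ℂ) * I) := by
  rw [map_mul, Complex.conj_ofReal, Complex.conj_I]
  ring

/-- Schwarz reflection for `ξ^{(-1)}`: `ξ^{(-1)}(s̄) = conj ξ^{(-1)}(s)` (tree: `riemannXiPrimitive_conj`,
`riemannXiPrimitive = xiIntegral`). [folklore] -/
theorem xiIntegral_conj (s : ℂ) : xiIntegral (conj s) = conj (xiIntegral s) := by
  have h := riemannXiPrimitive_conj s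
  rwa [riemannXiPrimitive_eq_xiIntegral] at h

/-- `‖ξ^{(-1)}(s̄) + iA₀‖ = ‖ξ^{(-1)}(s) − iA₀‖`: the lower half-plane statement (`t → −∞`, limit `−iA₀`)
is the conjugate of the upper one. [cite: LagariasMontague2011, §5 ("using the symmetries of ξ^{(-1)}")] -/
theorem norm_xiIntegral_conj_add (s : ℂ) :
    ‖xiIntegral (conj s) + (xiIntegralLimit : ℂ) * I‖ = ‖xiIntegral s - (xiIntegralLimit : ℂ) * I‖ := by
  have h : xiIntegral (conj s) + (xiIntegralLimit : ℂ) * I =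
      conj (xiIntegral s - (xiIntegralLimit : ℂ) * I) := by
    rw [map_sub, conj_xiIntegralLimit_mul_I, xiIntegral_conj]
    ring
  rw [h, Complex.norm_conj]

/-- `‖ξ^{(-1)}(1 − s̄) − iA₀‖ = ‖ξ^{(-1)}(s) − iA₀‖` (from `ξ^{(-1)}(1 − s̄) = −conj ξ^{(-1)}(s)`, LM Lemma 3.2 (2)):
the deviation from `iA₀` is symmetric under reflection in the critical line, so abscissae `σ < ½` reduce
to `1 − σ > ½`. [cite: LagariasMontague2011, Lemma 3.2 (2) and §5] -/
theorem norm_xiIntegral_one_sub_conj_sub (s : ℂ) :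
    ‖xiIntegral (1 - conj s) - (xiIntegralLimit : ℂ) * I‖ = ‖xiIntegral s - (xiIntegralLimit : ℂ) * I‖ := by
  have h1 : xiIntegral (1 - conj s) = -conj (xiIntegral s) := by
    have h := riemannXiPrimitive_one_sub_conj s
    rwa [riemannXiPrimitive_eq_xiIntegral] at h
  have h : xiIntegral (1 - conj s) - (xiIntegralLimit : ℂ) * I =
      -conj (xiIntegral s - (xiIntegralLimit : ℂ) * I) := by
    rw [h1, map_sub, conj_xiIntegralLimit_mul_I]
    ring
  rw [h, norm_neg, Complex.norm_conj]

/-! ## Step 2: `|ξ(x + it)| → 0` uniformly on right half-strips `½ ≤ x ≤ S` -/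

/-- **Stirling-order upper bound for `Γ` on `0 < x ≤ N + 1`**: for `|y| ≥ 1`,
`‖Γ(x + iy)‖ ≤ 16π² (x + |y| + N)^N (1 + |y|)^{1/2} e^{−π|y|/2}` — the tree's bound
`Literature.Analysis.SpecialFunctions.norm_Gamma_le_exp` on `0 < x ≤ 1` pushed to the right by the
recurrence `Γ(z + 1) = zΓ(z)`, `‖z‖ ≤ x + |y|` (induction on `N`). The true order is
`|y|^{x − 1/2} e^{−π|y|/2}` (Titchmarsh (4.12.2)); the crude polynomial factor is harmless against `e^{−π|y|/2}`.
[cite: Titchmarsh1986, §4.12 (4.12.2), consequence] -/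
theorem norm_Gamma_le_pow_mul_exp (N : ℕ) {x y : ℝ} (h0 : 0 < x) (hN : x ≤ N + 1) (hy : 1 ≤ |y|) :
    ‖Complex.Gamma (x + y * I)‖ ≤
      16 * π ^ 2 * (x + |y| + N) ^ N * (1 + |y|) ^ (1 / 2 : ℝ) * Real.exp (-(π * |y|) / 2) := by
  induction N generalizing x with
  | zero =>
    have h1 : x ≤ 1 := by simpa using hN
    have h := Literature.Analysis.SpecialFunctions.norm_Gamma_le_exp h0 h1 hy
    simpa using h
  | succ n ih =>
    have hy0 : 0 ≤ |y| := abs_nonneg y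
    have hn0 : (0:ℝ) ≤ n := Nat.cast_nonneg n
    rcases le_or_gt x (n + 1) with hle | hlt
    · refine (ih h0 hle).trans ?_
      have hb1 : 1 ≤ x + |y| + n := by linarith
      have hpow : (x + |y| + n) ^ n ≤ (x + |y| + ((n + 1 : ℕ) : ℝ)) ^ (n + 1) := by
        calc (x + |y| + n) ^ n ≤ (x + |y| + n) ^ (n + 1) := pow_le_pow_right₀ hb1 (Nat.le_succ n)
          _ ≤ (x + |y| + ((n + 1 : ℕ) : ℝ)) ^ (n + 1) := by
              apply pow_le_pow_left₀ (by linarith)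
              push_cast
              linarith
      calc 16 * π ^ 2 * (x + |y| + n) ^ n * (1 + |y|) ^ (1 / 2 : ℝ) * Real.exp (-(π * |y|) / 2)
          = (x + |y| + n) ^ n *
              (16 * π ^ 2 * (1 + |y|) ^ (1 / 2 : ℝ) * Real.exp (-(π * |y|) / 2)) := by ring
        _ ≤ (x + |y| + ((n + 1 : ℕ) : ℝ)) ^ (n + 1) *
              (16 * π ^ 2 * (1 + |y|) ^ (1 / 2 : ℝ) * Real.exp (-(π * |y|) / 2)) :=
            mul_le_mul_of_nonneg_right hpow (by positivity)
        _ = 16 * π ^ 2 * (x + |y| + ((n + 1 : ℕ) : ℝ)) ^ (n + 1) * (1 + |y|) ^ (1 / 2 : ℝ) *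
              Real.exp (-(π * |y|) / 2) := by ring
    · have hx1 : 0 < x - 1 := by linarith
      have hz : ((x - 1 : ℝ) : ℂ) + y * I ≠ 0 := by
        intro h
        have := congrArg Complex.re h
        simp at this
        linarith
      have hrec : Complex.Gamma (x + y * I) =
          (((x - 1 : ℝ) : ℂ) + y * I) * Complex.Gamma (((x - 1 : ℝ) : ℂ) + y * I) := by
        have e : ((x - 1 : ℝ) : ℂ) + y * I + 1 = x + y * I := by
          push_cast
          ring
        rw [← e]
        exact Complex.Gamma_add_one _ hz
      have hN' : x - 1 ≤ n + 1 := by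
        push_cast at hN
        linarith
      have h := ih hx1 hN'
      have hmod : ‖((x - 1 : ℝ) : ℂ) + y * I‖ ≤ x + |y| := by
        refine (Complex.norm_le_abs_re_add_abs_im _).trans ?_
        have hre : (((x - 1 : ℝ) : ℂ) + y * I).re = x - 1 := by simp
        have him : (((x - 1 : ℝ) : ℂ) + y * I).im = y := by simp
        rw [hre, him, abs_of_pos hx1]
        linarith
      rw [hrec, norm_mul]
      have hb0 : 0 ≤ x - 1 + |y| + n := by linarith
      have hpow1 : (x - 1 + |y| + n) ^ n ≤ (x + |y| + ((n + 1 : ℕ) : ℝ)) ^ n := by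
        apply pow_le_pow_left₀ hb0
        push_cast
        linarith
      have hlin : x + |y| ≤ x + |y| + ((n + 1 : ℕ) : ℝ) := by
        push_cast
        linarith
      have hE := Real.exp_pos (-(π * |y|) / 2)
      calc ‖((x - 1 : ℝ) : ℂ) + y * I‖ * ‖Complex.Gamma (((x - 1 : ℝ) : ℂ) + y * I)‖
          ≤ (x + |y|) * (16 * π ^ 2 * (x - 1 + |y| + n) ^ n * (1 + |y|) ^ (1 / 2 : ℝ) *
              Real.exp (-(π * |y|) / 2)) := mul_le_mul hmod h (norm_nonneg _) (by linarith)
        _ = ((x - 1 + |y| + n) ^ n * (x + |y|)) *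
              (16 * π ^ 2 * (1 + |y|) ^ (1 / 2 : ℝ) * Real.exp (-(π * |y|) / 2)) := by ring
        _ ≤ ((x + |y| + ((n + 1 : ℕ) : ℝ)) ^ n * (x + |y| + ((n + 1 : ℕ) : ℝ))) *
              (16 * π ^ 2 * (1 + |y|) ^ (1 / 2 : ℝ) * Real.exp (-(π * |y|) / 2)) := by
            apply mul_le_mul_of_nonneg_right _ (by positivity)
            exact mul_le_mul hpow1 hlin (by linarith) (by positivity)
        _ = 16 * π ^ 2 * (x + |y| + ((n + 1 : ℕ) : ℝ)) ^ (n + 1) * (1 + |y|) ^ (1 / 2 : ℝ) *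
              Real.exp (-(π * |y|) / 2) := by
            rw [pow_succ]
            ring

/-- **`ξ` beyond abscissa `2`, at Stirling order**: for `2 ≤ x ≤ 2(N + 1)` and `t ≥ 2`,
`‖ξ(x + it)‖ ≤ 16π² (x + t + N)^{N+3} e^{−πt/4}`. From `ξ(s) = ½ s(s−1) π^{−s/2} Γ(s/2) ζ(s)`
(Titchmarsh (2.1.12)): `‖½ s(s−1)‖ ≤ (x+t)²/2`, `‖π^{−s/2}‖ ≤ 1`, `norm_Gamma_le_pow_mul_exp` for `Γ(s/2)`,
and `‖ζ(s)‖ ≤ x/(x−1) ≤ 2`. This is the "well known" decay of `ξ` on vertical strips invoked in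
Lagarias–Montague §5 ("may be proved following Lemma 3.3 (1)"), on the part of the strip to the right of `2`.
[cite: LagariasMontague2011, §5 and Lemma 3.3 (1)] -/
theorem norm_riemannXi_le_pow_mul_exp (N : ℕ) {x t : ℝ} (h2 : 2 ≤ x) (hN : x ≤ 2 * (N + 1))
    (ht : 2 ≤ t) :
    ‖riemannXi (x + t * I)‖ ≤ 16 * π ^ 2 * (x + t + N) ^ (N + 3) * Real.exp (-(π / 4) * t) := by
  have hπ := Real.pi_pos
  set s : ℂ := x + t * I with hs
  have hsre : s.re = x := by simp [hs]
  have hsim : s.im = t := by simp [hs]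
  have hx0 : 0 < x := by linarith
  have ht0 : 0 < t := by linarith
  have hs0 : s ≠ 0 := fun h => by
    have := congrArg Complex.im h
    rw [hsim] at this
    simp at this
    linarith
  have hs1 : s ≠ 1 := fun h => by
    have := congrArg Complex.im h
    rw [hsim] at this
    simp at this
    linarith
  -- the factorisation `ξ(s) = ½ s(s−1) · π^{−s/2} Γ(s/2) ζ(s)`
  have hΛ : completedRiemannZeta s = Gammaℝ s * riemannZeta s := by
    rw [riemannZeta_def_of_ne_zero hs0]
    field_simp [Gammaℝ_ne_zero_of_re_pos (s := s) (by rw [hsre]; exact hx0)]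
  have hξ : riemannXi s =
      s * (s - 1) / 2 * ((Real.pi : ℂ) ^ (-s / 2) * Complex.Gamma (s / 2) * riemannZeta s) := by
    rw [riemannXi_eq_mul_completedRiemannZeta hs0 hs1, hΛ, Gammaℝ_def]
  -- norms of the factors
  have hns : ‖s‖ ≤ x + t := by
    calc ‖s‖ ≤ |s.re| + |s.im| := Complex.norm_le_abs_re_add_abs_im s
      _ = x + t := by rw [hsre, hsim, abs_of_pos hx0, abs_of_pos ht0]
  have hns1 : ‖s - 1‖ ≤ x + t := by
    calc ‖s - 1‖ ≤ |(s - 1).re| + |(s - 1).im| := Complex.norm_le_abs_re_add_abs_im _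
      _ = (x - 1) + t := by
          rw [Complex.sub_re, Complex.sub_im, Complex.one_re, Complex.one_im, hsre, hsim, sub_zero,
            abs_of_pos (by linarith), abs_of_pos ht0]
      _ ≤ x + t := by linarith
  have hquad : ‖s * (s - 1) / 2‖ ≤ (x + t) ^ 2 / 2 := by
    rw [norm_div, norm_mul, Complex.norm_two]
    have : ‖s‖ * ‖s - 1‖ ≤ (x + t) * (x + t) :=
      mul_le_mul hns hns1 (norm_nonneg _) (by linarith)
    nlinarith
  have hpi : ‖(Real.pi : ℂ) ^ (-s / 2)‖ ≤ 1 := by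
    rw [Complex.norm_cpow_eq_rpow_re_of_pos Real.pi_pos]
    refine Real.rpow_le_one_of_one_le_of_nonpos (by linarith [Real.pi_gt_three]) ?_
    have : (-s / 2).re = -s.re / 2 := by simp [neg_div]
    rw [this, hsre]
    linarith
  have hζ : ‖riemannZeta s‖ ≤ 2 := by
    have h := Literature.NumberTheory.LFunctions.ZetaClassicalRegion.norm_riemannZeta_le_of_one_lt_re
      (s := s) (by rw [hsre]; linarith)
    rw [hsre] at h
    have h3 : x / (x - 1) ≤ 2 := by
      rw [div_le_iff₀ (by linarith)]
      linarith
    exact h.trans h3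
  set E : ℝ := Real.exp (-(π / 4) * t) with hE
  have hE0 : 0 < E := Real.exp_pos _
  have hG : ‖Complex.Gamma (s / 2)‖ ≤
      16 * π ^ 2 * (x / 2 + t / 2 + N) ^ N * (1 + t / 2) ^ (1 / 2 : ℝ) * E := by
    have hs2 : s / 2 = ((x / 2 : ℝ) : ℂ) + ((t / 2 : ℝ) : ℂ) * I := by
      rw [hs]
      push_cast
      ring
    have habs : |t / 2| = t / 2 := abs_of_pos (by linarith)
    have hy : 1 ≤ |t / 2| := by
      rw [habs]
      linarith
    have h := norm_Gamma_le_pow_mul_exp N (x := x / 2) (y := t / 2) (by linarith) (by linarith) hy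
    rw [habs] at h
    have hexp : Real.exp (-(π * (t / 2)) / 2) = E := by
      rw [hE]
      congr 1
      ring
    rw [hexp] at h
    rw [hs2]
    exact h
  -- crude simplifications with `u = x + t + N ≥ 1`
  set u : ℝ := x + t + N with hu
  have hn0 : (0:ℝ) ≤ N := Nat.cast_nonneg N
  have hxt : x + t ≤ u := by
    rw [hu]
    linarith
  have h1 : (x / 2 + t / 2 + N) ^ N ≤ u ^ N :=
    pow_le_pow_left₀ (by positivity) (by rw [hu]; linarith) N
  have h2' : (1 + t / 2) ^ (1 / 2 : ℝ) ≤ u := by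
    have hb : 1 ≤ 1 + t / 2 := by linarith
    calc (1 + t / 2) ^ (1 / 2 : ℝ) ≤ (1 + t / 2) ^ (1 : ℝ) :=
          Real.rpow_le_rpow_of_exponent_le hb (by norm_num)
      _ = 1 + t / 2 := Real.rpow_one _
      _ ≤ u := by
          rw [hu]
          linarith
  have h3 : (x + t) ^ 2 ≤ u ^ 2 := pow_le_pow_left₀ (by linarith) hxt 2
  have hP : 0 ≤ (x / 2 + t / 2 + N) ^ N := by positivity
  have hR : 0 ≤ (1 + t / 2) ^ (1 / 2 : ℝ) := by positivity
  rw [hξ, norm_mul, norm_mul, norm_mul]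
  have k1 : ‖(π : ℂ) ^ (-s / 2)‖ * ‖Complex.Gamma (s / 2)‖ ≤
      1 * (16 * π ^ 2 * (x / 2 + t / 2 + N) ^ N * (1 + t / 2) ^ (1 / 2 : ℝ) * E) :=
    mul_le_mul hpi hG (norm_nonneg _) zero_le_one
  have k2 : ‖(π : ℂ) ^ (-s / 2)‖ * ‖Complex.Gamma (s / 2)‖ * ‖riemannZeta s‖ ≤
      1 * (16 * π ^ 2 * (x / 2 + t / 2 + N) ^ N * (1 + t / 2) ^ (1 / 2 : ℝ) * E) * 2 :=
    mul_le_mul k1 hζ (norm_nonneg _) (by positivity)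
  have k3 : ‖s * (s - 1) / 2‖ * (‖(π : ℂ) ^ (-s / 2)‖ * ‖Complex.Gamma (s / 2)‖ * ‖riemannZeta s‖) ≤
      (x + t) ^ 2 / 2 *
        (1 * (16 * π ^ 2 * (x / 2 + t / 2 + N) ^ N * (1 + t / 2) ^ (1 / 2 : ℝ) * E) * 2) :=
    mul_le_mul hquad k2 (by positivity) (by positivity)
  refine k3.trans ?_
  have k4 : (x + t) ^ 2 * (x / 2 + t / 2 + N) ^ N * (1 + t / 2) ^ (1 / 2 : ℝ) ≤ u ^ 2 * u ^ N * u :=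
    mul_le_mul (mul_le_mul h3 h1 hP (by positivity)) h2' hR (by positivity)
  calc (x + t) ^ 2 / 2 *
        (1 * (16 * π ^ 2 * (x / 2 + t / 2 + N) ^ N * (1 + t / 2) ^ (1 / 2 : ℝ) * E) * 2)
      = 16 * π ^ 2 * E * ((x + t) ^ 2 * (x / 2 + t / 2 + N) ^ N * (1 + t / 2) ^ (1 / 2 : ℝ)) := by
        ring
    _ ≤ 16 * π ^ 2 * E * (u ^ 2 * u ^ N * u) := mul_le_mul_of_nonneg_left k4 (by positivity)
    _ = 16 * π ^ 2 * u ^ (N + 3) * E := by ring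

/-- **`|ξ(s)| → 0` as `t → +∞`, uniformly on right half-strips**: for every `S` there is `g` with `g(t) → 0`
(`t → +∞`) and `‖ξ(x + it)‖ ≤ g(t)` for `½ ≤ x ≤ S`, `t ≥ 2` (Lemma 3.3 (1) on `[½, 2]`,
`norm_riemannXi_le_pow_mul_exp` on `[2, S]`; `tᵏ e^{−πt/4} → 0`). This is the "well known fact that
`|ξ(s)| → 0` as `|t| → ∞`, uniformly on any vertical strip" of Lagarias–Montague §5, on the half of the
strip to the right of the critical line (the other half follows by `ξ(1 − s) = ξ(s)`).
[cite: LagariasMontague2011, §5] -/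
theorem exists_tendsto_norm_riemannXi_le (S : ℝ) :
    ∃ g : ℝ → ℝ, Tendsto g atTop (𝓝 0) ∧
      ∀ x t : ℝ, 1 / 2 ≤ x → x ≤ S → 2 ≤ t → ‖riemannXi (x + t * I)‖ ≤ g t := by
  obtain ⟨C₁, hC₁, hb⟩ := LagariasMontague2011_lem_3_3_i_holds
  have hπ := Real.pi_pos
  set N : ℕ := ⌈S⌉₊ with hN
  have hSN : S ≤ N := Nat.le_ceil S
  have hn0 : (0:ℝ) ≤ N := Nat.cast_nonneg N
  set K : ℝ := 1 + |S| + N with hK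
  have hS0 : 0 ≤ |S| := abs_nonneg S
  have hK1 : 1 ≤ K := by
    rw [hK]
    linarith
  have hb0 : 0 < π / 4 := by positivity
  refine ⟨fun t => 8 * C₁ * (t ^ 3 / Real.exp (π / 4 * t)) +
      16 * π ^ 2 * K ^ (N + 3) * (t ^ (N + 3) / Real.exp (π / 4 * t)), ?_, ?_⟩
  · have h3 := (isLittleO_pow_exp_pos_mul_atTop 3 hb0).tendsto_div_nhds_zero
    have hN3 := (isLittleO_pow_exp_pos_mul_atTop (N + 3) hb0).tendsto_div_nhds_zero
    have h := (h3.const_mul (8 * C₁)).add (hN3.const_mul (16 * π ^ 2 * K ^ (N + 3)))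
    rw [mul_zero, mul_zero, add_zero] at h
    exact h
  · intro x t hx hxS ht
    have ht0 : 0 < t := by linarith
    have ht1 : 1 ≤ t := by linarith
    have hE : Real.exp (-(π / 4) * t) = (Real.exp (π / 4 * t))⁻¹ := by
      rw [← Real.exp_neg]
      congr 1
      ring
    have hexp0 : 0 < Real.exp (π / 4 * t) := Real.exp_pos _
    have hA0 : 0 ≤ 8 * C₁ * (t ^ 3 / Real.exp (π / 4 * t)) := by positivity
    have hB0 : 0 ≤ 16 * π ^ 2 * K ^ (N + 3) * (t ^ (N + 3) / Real.exp (π / 4 * t)) := by positivity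
    rcases le_or_gt x 2 with hx2 | hx2
    · -- `½ ≤ x ≤ 2`: Lemma 3.3 (1)
      have hsre : ((x : ℂ) + t * I).re = x := by simp
      have hsim : ((x : ℂ) + t * I).im = t := by simp
      have h := hb ((x : ℂ) + t * I) (by rw [hsre]; exact hx) (by rw [hsre]; exact hx2)
      rw [hsim, abs_of_pos ht0] at h
      have hpow : (t + 1) ^ (5 / 2 : ℝ) ≤ 8 * t ^ 3 := by
        have hb1 : 1 ≤ t + 1 := by linarith
        calc (t + 1) ^ (5 / 2 : ℝ) ≤ (t + 1) ^ ((3 : ℕ) : ℝ) :=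
              Real.rpow_le_rpow_of_exponent_le hb1 (by norm_num)
          _ = (t + 1) ^ 3 := Real.rpow_natCast _ 3
          _ ≤ (2 * t) ^ 3 := pow_le_pow_left₀ (by linarith) (by linarith) 3
          _ = 8 * t ^ 3 := by ring
      have hC0 : 0 ≤ C₁ * Real.exp (-(π / 4) * t) := by positivity
      calc ‖riemannXi (x + t * I)‖ ≤ C₁ * Real.exp (-(π / 4) * t) * (t + 1) ^ (5 / 2 : ℝ) := h
        _ ≤ C₁ * Real.exp (-(π / 4) * t) * (8 * t ^ 3) := mul_le_mul_of_nonneg_left hpow hC0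
        _ = 8 * C₁ * (t ^ 3 / Real.exp (π / 4 * t)) := by
            rw [hE, div_eq_mul_inv]
            ring
        _ ≤ _ := le_add_of_nonneg_right hB0
    · -- `2 < x ≤ S`: Stirling order
      have hxN : x ≤ 2 * (N + 1) := by linarith
      have h := norm_riemannXi_le_pow_mul_exp N hx2.le hxN ht
      have hu : x + t + N ≤ K * t := by
        have h1 : x ≤ |S| := hxS.trans (le_abs_self S)
        have h2 : (|S| + N) * 1 ≤ (|S| + N) * t := mul_le_mul_of_nonneg_left ht1 (by positivity)
        rw [hK]
        nlinarith
      have hu0 : 0 ≤ x + t + N := by linarith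
      have hpow : (x + t + N) ^ (N + 3) ≤ K ^ (N + 3) * t ^ (N + 3) := by
        rw [← mul_pow]
        exact pow_le_pow_left₀ hu0 hu _
      have hC0 : 0 ≤ 16 * π ^ 2 := by positivity
      calc ‖riemannXi (x + t * I)‖ ≤ 16 * π ^ 2 * (x + t + N) ^ (N + 3) * Real.exp (-(π / 4) * t) := h
        _ ≤ 16 * π ^ 2 * (K ^ (N + 3) * t ^ (N + 3)) * Real.exp (-(π / 4) * t) :=
            mul_le_mul_of_nonneg_right (mul_le_mul_of_nonneg_left hpow hC0) (Real.exp_pos _).le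
        _ = 16 * π ^ 2 * K ^ (N + 3) * (t ^ (N + 3) / Real.exp (π / 4 * t)) := by
            rw [hE, div_eq_mul_inv]
            ring
        _ ≤ _ := le_add_of_nonneg_left hA0

/-! ## Step 3: assembly -/

/-- **Uniform convergence on right half-strips**: for every `S` and `ε > 0` there is `T ≥ 2` with
`‖ξ^{(-1)}(x + it) − iA₀‖ < ε` for all `½ ≤ x ≤ S`, `t ≥ T`. As in Lagarias–Montague §5:
`ξ^{(-1)}(x + it) = ξ^{(-1)}(½ + it) + ∫_{1/2}^{x} ξ(y + it) dy` (`xiIntegral_sub_eq_integral_horizontal`),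
the first term tends to `iA₀` (Thm. 2.1 (1), `LagariasMontague2011_thm_2_1_i_holds`) and the integrand is
uniformly small (`exists_tendsto_norm_riemannXi_le`) on a segment of length `≤ S − ½`.
[cite: LagariasMontague2011, §5 (facts (1)–(2), p. 13)] -/
theorem xiIntegral_tendsto_uniform_right (S ε : ℝ) (hε : 0 < ε) :
    ∃ T : ℝ, 2 ≤ T ∧ ∀ x t : ℝ, 1 / 2 ≤ x → x ≤ S → T ≤ t →
      ‖xiIntegral (x + t * I) - (xiIntegralLimit : ℂ) * I‖ < ε := by
  obtain ⟨g, hg, hgb⟩ := exists_tendsto_norm_riemannXi_le (max S 2)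
  have hS2 : (2 : ℝ) ≤ max S 2 := le_max_right S 2
  set L : ℝ := max S 2 - 1 / 2 with hL
  have hL0 : 0 < L := by
    rw [hL]
    linarith
  -- `T₁` from Thm. 2.1 (1)
  have h1 := LagariasMontague2011_thm_2_1_i_holds.1
  rw [Metric.tendsto_atTop] at h1
  obtain ⟨T₁, hT₁⟩ := h1 (ε / 2) (by positivity)
  -- `T₂` from the uniform decay of `ξ`
  rw [Metric.tendsto_atTop] at hg
  obtain ⟨T₂, hT₂⟩ := hg (ε / (4 * L)) (by positivity)
  refine ⟨max (max T₁ T₂) 2, le_max_right _ _, fun x t hx hxS hT => ?_⟩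
  have ht1 : T₁ ≤ t := le_trans (le_trans (le_max_left _ _) (le_max_left _ _)) hT
  have ht2 : T₂ ≤ t := le_trans (le_trans (le_max_right _ _) (le_max_left _ _)) hT
  have ht0 : 2 ≤ t := le_trans (le_max_right _ _) hT
  have hcrit : ‖xiIntegral (1 / 2 + t * I) - (xiIntegralLimit : ℂ) * I‖ < ε / 2 := by
    have h := hT₁ t ht1
    rwa [dist_eq_norm] at h
  have hgt : g t < ε / (4 * L) := by
    have h := hT₂ t ht2
    rw [Real.dist_eq, sub_zero] at h
    exact lt_of_le_of_lt (le_abs_self _) h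
  have hhor : ‖xiIntegral (x + t * I) - xiIntegral (1 / 2 + t * I)‖ ≤ ε / 4 := by
    rw [xiIntegral_sub_eq_integral_horizontal]
    have hle : ∀ y ∈ Set.uIoc (1 / 2 : ℝ) x, ‖riemannXi (y + t * I)‖ ≤ ε / (4 * L) := by
      intro y hy
      rw [Set.uIoc_of_le hx] at hy
      have hyS : y ≤ max S 2 := hy.2.trans (hxS.trans (le_max_left _ _))
      exact (hgb y t hy.1.le hyS ht0).trans hgt.le
    calc ‖∫ y in (1 / 2 : ℝ)..x, riemannXi (y + t * I)‖ ≤ ε / (4 * L) * |x - 1 / 2| :=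
          intervalIntegral.norm_integral_le_of_norm_le_const hle
      _ ≤ ε / (4 * L) * L := by
          apply mul_le_mul_of_nonneg_left _ (by positivity)
          rw [abs_of_nonneg (by linarith)]
          have := le_max_left S 2
          rw [hL]
          linarith
      _ = ε / 4 := by
          field_simp
  calc ‖xiIntegral (x + t * I) - (xiIntegralLimit : ℂ) * I‖
      ≤ ‖xiIntegral (x + t * I) - xiIntegral (1 / 2 + t * I)‖ +
          ‖xiIntegral (1 / 2 + t * I) - (xiIntegralLimit : ℂ) * I‖ :=
        norm_sub_le_norm_sub_add_norm_sub _ _ _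
    _ < ε / 4 + ε / 2 := add_lt_add_of_le_of_lt hhor hcrit
    _ ≤ ε := by linarith

/-- **Discharge of `Literature.NumberTheory.LFunctions.LagariasMontague2011_sec5_uniform`** (Lagarias–Montague
2011, §5, facts (1)–(2) at the start of the proof of Thm. 2.2, p. 13): for every strip `σ₁ ≤ σ ≤ σ₂` and
`ε > 0` there is `T` with `‖ξ^{(-1)}(σ + it) − iA₀‖ < ε` and `‖ξ^{(-1)}(σ − it) + iA₀‖ < ε` for all
`σ ∈ [σ₁, σ₂]`, `t ≥ T`. The right half-strip `½ ≤ σ ≤ max(σ₂, 1 − σ₁)` is `xiIntegral_tendsto_uniform_right`;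
`σ < ½` and the lower half-plane follow from the symmetries `ξ^{(-1)}(1 − s̄) = −conj ξ^{(-1)}(s)`,
`ξ^{(-1)}(s̄) = conj ξ^{(-1)}(s)` (Step 1). [cite: LagariasMontague2011, §5 (facts (1)–(2), p. 13)] -/
theorem LagariasMontague2011_sec5_uniform_holds : LagariasMontague2011_sec5_uniform := by
  intro σ₁ σ₂ ε hε
  obtain ⟨T, -, hT⟩ := xiIntegral_tendsto_uniform_right (max σ₂ (1 - σ₁)) ε hε
  refine ⟨T, fun σ t h1 h2 ht => ?_⟩
  have hpos : ‖xiIntegral (σ + t * I) - (xiIntegralLimit : ℂ) * I‖ < ε := by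
    rcases le_or_gt (1 / 2 : ℝ) σ with hσ | hσ
    · exact hT σ t hσ (h2.trans (le_max_left _ _)) ht
    · have hmax := le_max_right σ₂ (1 - σ₁)
      have h := hT (1 - σ) t (by linarith) (by linarith) ht
      have hs : (σ : ℂ) + t * I = 1 - conj (((1 - σ : ℝ) : ℂ) + t * I) := by
        apply Complex.ext
        · simp
        · simp
      rw [hs, norm_xiIntegral_one_sub_conj_sub]
      exact h
  refine ⟨hpos, ?_⟩
  have hs : (σ : ℂ) + -(t : ℂ) * I = conj ((σ : ℂ) + t * I) := by
    apply Complex.ext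
    · simp
    · simp
  rw [hs, norm_xiIntegral_conj_add]
  exact hpos

end Literature.NumberTheory.LFunctions
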